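import Mathlib.NumberTheory.Padics.Hensel
import Mathlib.NumberTheory.Padics.RingHoms
import Mathlib.RingTheory.Ideal.Norm.AbsNorm
import Mathlib.NumberTheory.NumberField.Basic
import Literature.NumberTheory.NumberFields.CubicFieldExplicit
import Summits.BirchSwinnertonDyer.BirchSwinnertonDyer.Theorems.Rank2Observatory2DescLinGens
import Summits.BirchSwinnertonDyer.BirchSwinnertonDyer.Theorems.Rank2Observatory2DescPadicRoot
import Summits.BirchSwinnertonDyer.BirchSwinnertonDyer.Theorems.Rank2Observatory2DescPadicRootMem
import Summits.BirchSwinnertonDyer.BirchSwinnertonDyer.Theorems.Rank2Observatory2DescPadicRootCover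
import HarnessLib

/-!
# KERNEL-2DESC-CL, `p`-adic ROOT VIEW (part D4): the packaged certificate at a totally split prime

HONEST FRAMING: per-curve certified theorems and census instruments; no claim on BSD in rank ≥ 2.

`RootedPrime hθ p a N` packages an embedding `φ : K → ℚ_p` with `‖φ θ - a‖ ≤ p^(-N)` (produced from a
Hensel certificate by `rootedPrime_of_henselCheck`); its prime is `P = primeOf φ` (maximal, `∋ p`, norm `p`),
and parts D2's certificates decide `X(θ)/m ∈ P`.  `cover_of_triple`: three such packages with pairwise
separating elements give every prime above `p`. [folklore]
-/

noncomputable section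

set_option linter.dupNamespace false

open Polynomial NumberField Ideal Literature.NumberTheory.NumberFields

namespace Summit.BirchSwinnertonDyer.BirchSwinnertonDyer.Rank2Observatory.TwoDescPadic

section Triple

variable {K : Type*} [Field K] [NumberField K] {A B C : ℤ} {θ : K} {p : ℕ} [hp : Fact p.Prime]

/-- An embedding `K → ℚ_p` whose value at `θ` is a `p`-adic integer within `p^(-N)` of `a`. [folklore] -/
structure RootedPrime (θ : K) (p : ℕ) [Fact p.Prime] (a : ℤ) (N : ℕ) where
  /-- the root -/
  z : ℤ_[p]
  /-- the embedding -/
  φ : K →+* ℚ_[p]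
  φ_theta : φ θ = (z : ℚ_[p])
  close : ‖z - (a : ℤ_[p])‖ ≤ (p : ℝ) ^ (-(N : ℤ))

/-- **From a Hensel certificate to a rooted prime.** [folklore] -/
theorem nonempty_rootedPrime_of_henselCheck (hirr : Irreducible (MonicCubic.polyQ A B C))
    (hθ : aeval θ (MonicCubic.poly A B C) = 0) (h3 : Module.finrank ℚ K = 3) {a : ℤ} {d N : ℕ}
    (h : henselCheck A B C p a d N = true) : Nonempty (RootedPrime θ p a N) := by
  obtain ⟨z, hz, hza⟩ := exists_root_of_henselCheck h
  obtain ⟨φ, hφ⟩ := exists_emb_of_root hirr hθ h3 hz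
  exact ⟨⟨z, φ, hφ, hza⟩⟩

namespace RootedPrime

variable {a : ℤ} {N : ℕ} (R : RootedPrime θ p a N)

/-- The prime of a rooted prime, as a height-one prime. -/
def spec : IsDedekindDomain.HeightOneSpectrum (𝓞 K) := primeOfSpec R.φ

/-- The height-one prime `R.spec` has underlying ideal `primeOf R.φ` (by definition). -/
theorem spec_asIdeal : R.spec.asIdeal = primeOf R.φ := rfl

/-- The prime `primeOf R.φ` of a root triple is maximal. -/
theorem isMaximal : (primeOf R.φ).IsMaximal := primeOf_isMaximal R.φ

/-- The rational prime `p` lies in `primeOf R.φ`. -/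
theorem natCast_mem : ((p : ℕ) : 𝓞 K) ∈ primeOf R.φ := natCast_mem_primeOf R.φ

/-- `primeOf R.φ` has absolute norm `p` (residue degree one). -/
theorem absNorm_eq : absNorm (primeOf R.φ) = p := absNorm_primeOf R.φ

/-- Membership of `x = X(θ)/m` from the certificate. -/
theorem mem (hθ : aeval θ (MonicCubic.poly A B C) = 0) {m : ℤ} {v : ℕ} {X₀ X₁ X₂ : ℤ} {x : 𝓞 K}
    (hx : (m : 𝓞 K) * x = TwoDescCubic.lin hθ X₀ X₁ X₂) (hc : memCheck p a N m v X₀ X₁ X₂ = true) :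
    x ∈ primeOf R.φ :=
  mem_primeOf_of_memCheck hθ R.φ R.φ_theta R.close hx hc

/-- Non-membership of `x = X(θ)/m` from the certificate. -/
theorem not_mem (hθ : aeval θ (MonicCubic.poly A B C) = 0) {m : ℤ} {v : ℕ} {X₀ X₁ X₂ : ℤ} {x : 𝓞 K}
    (hx : (m : 𝓞 K) * x = TwoDescCubic.lin hθ X₀ X₁ X₂) (hc : notMemCheck p a N m v X₀ X₁ X₂ = true) :
    x ∉ primeOf R.φ :=
  not_mem_primeOf_of_notMemCheck hθ R.φ R.φ_theta R.close hx hc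

end RootedPrime

/-- **Covering from a certified triple**: three rooted primes at `p` with pairwise separating elements
`s ∈ P₁ \\ P₂`, `t ∈ P₁ \\ P₃`, `u ∈ P₂ \\ P₃` (each presented as `m·x = X(θ)` with D2 certificates) give
`(p) = P₁P₂P₃` and every prime above `p`. [folklore] -/
theorem cover_of_triple (hθ : aeval θ (MonicCubic.poly A B C) = 0) (h3 : Module.finrank ℚ K = 3)
    {a₁ a₂ a₃ : ℤ} {N₁ N₂ N₃ : ℕ}
    (R₁ : RootedPrime θ p a₁ N₁) (R₂ : RootedPrime θ p a₂ N₂) (R₃ : RootedPrime θ p a₃ N₃)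
    {ms mt mu : ℤ} {vs vt vu : ℕ} {S₀ S₁ S₂ T₀ T₁ T₂ U₀ U₁ U₂ : ℤ} {s t u : 𝓞 K}
    (hs : (ms : 𝓞 K) * s = TwoDescCubic.lin hθ S₀ S₁ S₂)
    (hs₁ : memCheck p a₁ N₁ ms vs S₀ S₁ S₂ = true) (hs₂ : notMemCheck p a₂ N₂ ms vs S₀ S₁ S₂ = true)
    (ht : (mt : 𝓞 K) * t = TwoDescCubic.lin hθ T₀ T₁ T₂)
    (ht₁ : memCheck p a₁ N₁ mt vt T₀ T₁ T₂ = true) (ht₃ : notMemCheck p a₃ N₃ mt vt T₀ T₁ T₂ = true)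
    (hu : (mu : 𝓞 K) * u = TwoDescCubic.lin hθ U₀ U₁ U₂)
    (hu₂ : memCheck p a₂ N₂ mu vu U₀ U₁ U₂ = true) (hu₃ : notMemCheck p a₃ N₃ mu vu U₀ U₁ U₂ = true) :
    span {((p : ℕ) : 𝓞 K)} = primeOf R₁.φ * primeOf R₂.φ * primeOf R₃.φ ∧
      ∀ w : IsDedekindDomain.HeightOneSpectrum (𝓞 K), ((p : ℕ) : 𝓞 K) ∈ w.asIdeal →
        w = R₁.spec ∨ w = R₂.spec ∨ w = R₃.spec := by
  have h12 : primeOf R₁.φ ≠ primeOf R₂.φ := ne_of_mem_of_not_mem (R₁.mem hθ hs hs₁) (R₂.not_mem hθ hs hs₂)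
  have h13 : primeOf R₁.φ ≠ primeOf R₃.φ := ne_of_mem_of_not_mem (R₁.mem hθ ht ht₁) (R₃.not_mem hθ ht ht₃)
  have h23 : primeOf R₂.φ ≠ primeOf R₃.φ := ne_of_mem_of_not_mem (R₂.mem hθ hu hu₂) (R₃.not_mem hθ hu hu₃)
  refine ⟨span_eq_mul_three h3 hp.out R₁.isMaximal R₂.isMaximal R₃.isMaximal h12 h13 h23
    R₁.natCast_mem R₂.natCast_mem R₃.natCast_mem R₁.absNorm_eq R₂.absNorm_eq R₃.absNorm_eq, ?_⟩
  intro w hw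
  rcases eq_or_eq_or_eq_of_three h3 hp.out R₁.isMaximal R₂.isMaximal R₃.isMaximal h12 h13 h23
    R₁.natCast_mem R₂.natCast_mem R₃.natCast_mem R₁.absNorm_eq R₂.absNorm_eq R₃.absNorm_eq
    w.asIdeal w.isPrime hw with h | h | h
  · left; exact IsDedekindDomain.HeightOneSpectrum.ext h
  · right; left; exact IsDedekindDomain.HeightOneSpectrum.ext h
  · right; right; exact IsDedekindDomain.HeightOneSpectrum.ext h

end Triple

end Summit.BirchSwinnertonDyer.BirchSwinnertonDyer.Rank2Observatory.TwoDescPadic
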